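import Summits.QuantumFields.YangMills.Theorems.FlatTubeReductionPinnedSpanStepKinematics
import Summits.QuantumFields.YangMills.Theorems.FemtoTransferGapMomentConvexity
import HarnessLib

/-!
# Route `FlatTubeReduction` (LINE g6-A «unit-slab ladder») — MOMENTUM SPLIT of the raw pinned trial:
# raw autocorrelation = averaged autocorrelation + non-zero-momentum autocorrelation, all three non-negative
# (bears on crux `UnitUpStep` stmt-QuantumFields-27556; R2b1 RECORD rung — no summit)

Seat ym-line-fcl-p3 g11 (2026-08-28).  For a translation-invariant physical `Ω` with `‖Ω‖ = 1` (the fine ground state), a physical multiplier `F`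
(in the engines `F = (φ′/Ω′) ∘ thin L′`), its fine-translation average `F̄ = |Λ|⁻¹ Σ_v F∘τ_v` and the remainder `r = (F − F̄)·Ω` (the non-zero
fine-momentum part of the raw trial `w₀ = F·Ω`; `w̄ = F̄·Ω` is the plain-average trial of the filed cruxes):
* `PinnedSpan.integral_ti_mul_sub_avg` — `∫ G·(F − F̄) = 0` for translation-invariant physical `G` (change of variables `τ_v`);
* `PinnedSpan.l2_remainder_of_ti` — hence `⟨H·?, r⟩`: `⟨H, r⟩ = 0` for every translation-invariant physical `H`; in particular `⟨Ω, r⟩ = 0` and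
  `⟨K_β^n w̄, r⟩ = 0` (`K_β` commutes with translations: `PinnedSpan.iterate_transferApply_ti`);
* ★ `PinnedSpan.recentredMoment_raw_eq` — the SPLIT: `R_n(w₀) = R_n(w̄) + ⟨r, K_β^n r⟩` where `R_n(w) = ⟨w,K_β^n w⟩ − λ₀^n⟨w,Ω⟩²`, with
  `0 ≤ ⟨r, K_β^n r⟩` (`moment_nonneg`); at `n = 0`: `Var(w₀) = Var(w̄) + ‖r‖²`;
* ★★ `PinnedSpan.rawComparison_of_avg_of_leak` — consequently the RAW comparison with slack `s₁ + s₂` follows from the AVERAGED comparison with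
  slack `s₁` (stated robustly: true even when `Var(w̄) = 0`) and the LEAK bound `‖r‖² ≤ (1 − e^{−s₂})·Var(w₀)` (non-zero-momentum weight of the raw
  pull-back under the fine vacuum); and `PinnedSpan.avgComparison_le_raw`: `R_n(w̄) ≤ R_n(w₀)`, `Var(w̄) ≤ Var(w₀)`.
READING for the supplier of `RawPinnedUnitStep` (crux 27556, skeleton candidate «raw-unit»): the raw stub = (slow-sector two-cutoff comparison of the
zero-momentum part, the (P2) wall) + (translation-regularity of the pulled-back coarse excitation under the FINE vacuum: leading order
`‖r‖²/Var ≈ 0.66·ε₁·Λ·log L/L²` at one doubled slab, memo MOMENTUM-COVARIANT-ENGINE / ALIASING.md), with no translation-invariance or smear-injectivity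
hypothesis anywhere.  HONEST FRAMING: fixed-lattice linear algebra only; nothing here is the comparison itself, a crux, the rung or a summit.
References: M. Reed, B. Simon IV (1978) [cite: ReedSimonIV1978, Thm. XIII.1]; M. Lüscher, NPB 219 (1983) [cite: Luscher1983, §3].
-/

set_option autoImplicit false

noncomputable section

open MeasureTheory
open Literature.MathematicalPhysics.QuantumFieldTheory (Site Edge GaugeConfig gaugeTransform torusConfigShift torusConfigShift_apply)
open Literature.MathematicalPhysics.QuantumLattice

namespace Summit.QuantumFields.YangMills.Theorems.FlatTubeReduction.PinnedSpan

open Summit.QuantumFields.YangMills.Theorems.FemtoTransferGap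
open Summit.QuantumFields.YangMills.Theses.FlatTubeReduction
open Summit.QuantumFields.YangMills.Theorems.FemtoCutoffLadder
open Summit.QuantumFields.YangMills.Theorems.FemtoCutoffLadder.Thinning (thin)

variable {L : ℕ} [NeZero L]

/-! ## Translation averages -/

/-- The fine-translation average `F̄ = |Λ_L|⁻¹ Σ_v F ∘ τ_v` of a physical `F` is physical. [folklore] -/
theorem isPhys_avg {F : GaugeConfig 3 L SU2 → ℝ} (hF : IsPhys F) :
    IsPhys (fun U : GaugeConfig 3 L SU2 => (Fintype.card (Site 3 L) : ℝ)⁻¹ * ∑ v : Site 3 L, F (torusConfigShift v U)) := by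
  have hs := isPhys_sum_mul Finset.univ (fun (v : Site 3 L) (U : GaugeConfig 3 L SU2) => F (torusConfigShift v U))
    (fun v => hF.comp_torusConfigShift v) (fun _ => (Fintype.card (Site 3 L) : ℝ)⁻¹)
  have e : (fun U : GaugeConfig 3 L SU2 => (Fintype.card (Site 3 L) : ℝ)⁻¹ * ∑ v : Site 3 L, F (torusConfigShift v U)) =
      fun U => ∑ v ∈ Finset.univ, (Fintype.card (Site 3 L) : ℝ)⁻¹ * F (torusConfigShift v U) := by
    funext U; rw [Finset.mul_sum]
  rw [e]; exact hs

/-- `∫ G·(F − F̄) = 0` for a translation-invariant physical `G` and a physical `F`: every translate `F ∘ τ_v` has the same `G`-weighted mean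
(change of variables `integral_comp_torusConfigShift`). [folklore] -/
theorem integral_ti_mul_sub_avg {G F : GaugeConfig 3 L SU2 → ℝ} (hG : IsPhys G) (hF : IsPhys F)
    (hGTI : ∀ (v : Site 3 L) (U : GaugeConfig 3 L SU2), G (torusConfigShift v U) = G U) :
    ∫ U, G U * (F U - (Fintype.card (Site 3 L) : ℝ)⁻¹ * ∑ v : Site 3 L, F (torusConfigShift v U)) ∂(configMeasure SU2 L) = 0 := by
  have hcard : (0 : ℝ) < (Fintype.card (Site 3 L) : ℝ) := by exact_mod_cast Fintype.card_pos
  -- each translate integrates against `G` like `F` itself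
  have hI : ∀ v : Site 3 L, ∫ U, G U * F (torusConfigShift v U) ∂(configMeasure SU2 L) = ∫ U, G U * F U ∂(configMeasure SU2 L) := by
    intro v
    have h := integral_comp_torusConfigShift v (fun U : GaugeConfig 3 L SU2 => G U * F U)
    simp only [hGTI v] at h
    exact h
  have hint : ∀ v ∈ (Finset.univ : Finset (Site 3 L)),
      Integrable (fun U => (Fintype.card (Site 3 L) : ℝ)⁻¹ * (G U * F (torusConfigShift v U))) (configMeasure SU2 L) :=
    fun v _ => (hG.integrable_mul (hF.comp_torusConfigShift v)).const_mul _
  have hGF : Integrable (fun U => G U * F U) (configMeasure SU2 L) := hG.integrable_mul hF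
  have hsplit : (fun U => G U * (F U - (Fintype.card (Site 3 L) : ℝ)⁻¹ * ∑ v : Site 3 L, F (torusConfigShift v U))) =
      fun U => G U * F U - ∑ v : Site 3 L, (Fintype.card (Site 3 L) : ℝ)⁻¹ * (G U * F (torusConfigShift v U)) := by
    funext U
    rw [mul_sub, Finset.mul_sum, Finset.mul_sum]
    congr 1
    exact Finset.sum_congr rfl fun v _ => by ring
  rw [hsplit, integral_sub hGF (integrable_finsetSum _ hint), integral_finsetSum _ hint]
  simp only [integral_const_mul, hI, Finset.sum_const, Finset.card_univ, nsmul_eq_mul]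
  field_simp
  ring

/-- Pairing form: `⟨H, (F − F̄)·Ω⟩ = 0` for translation-invariant physical `H`, `Ω` and physical `F` — the non-zero-momentum remainder of the
raw trial is orthogonal to every translation-invariant physical vector. [folklore] -/
theorem l2_remainder_of_ti {H F Ω : GaugeConfig 3 L SU2 → ℝ} (hH : IsPhys H) (hF : IsPhys F) (hΩ : IsPhys Ω)
    (hHTI : ∀ (v : Site 3 L) (U : GaugeConfig 3 L SU2), H (torusConfigShift v U) = H U)
    (hΩTI : ∀ (v : Site 3 L) (U : GaugeConfig 3 L SU2), Ω (torusConfigShift v U) = Ω U) :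
    l2 H (fun U => (F U - (Fintype.card (Site 3 L) : ℝ)⁻¹ * ∑ v : Site 3 L, F (torusConfigShift v U)) * Ω U) = 0 := by
  obtain ⟨C, hC⟩ := hΩ.bounded
  have hHΩ : IsPhys (fun U => H U * Ω U) := by
    have := IsPhys.mul_of_invariant hH hΩ.measurable hC hΩ.gaugeInv hΩ.zeroFlux
    simpa [mul_comm] using this
  have hti : ∀ (v : Site 3 L) (U : GaugeConfig 3 L SU2), H (torusConfigShift v U) * Ω (torusConfigShift v U) = H U * Ω U :=
    fun v U => by rw [hHTI, hΩTI]
  have h := integral_ti_mul_sub_avg hHΩ hF hti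
  unfold l2
  rw [← h]
  exact integral_congr_ae (ae_of_all _ fun U => by ring)

/-- `K_β^n` preserves translation invariance (the kernel is translation invariant). [folklore] -/
theorem iterate_transferApply_ti (β : ℝ) {ψ : GaugeConfig 3 L SU2 → ℝ}
    (hψTI : ∀ (v : Site 3 L) (U : GaugeConfig 3 L SU2), ψ (torusConfigShift v U) = ψ U) (n : ℕ)
    (v : Site 3 L) (U : GaugeConfig 3 L SU2) :
    (transferApply β)^[n] ψ (torusConfigShift v U) = (transferApply β)^[n] ψ U := by
  induction n generalizing U with
  | zero => exact hψTI v U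
  | succ n ih =>
    rw [Function.iterate_succ_apply']
    have hfun : (fun W => (transferApply β)^[n] ψ (torusConfigShift v W)) = (transferApply β)^[n] ψ := funext fun W => ih W
    have h := congrFun (GroundStateUnique.transferApply_comp_torusConfigShift β v ((transferApply β)^[n] ψ)) U
    rw [hfun] at h
    exact h.symm

/-- `l2` is additive in its second argument on physical test functions. [folklore] -/
theorem l2_add_right_phys {ψ φ φ' : GaugeConfig 3 L SU2 → ℝ} (hψ : IsPhys ψ) (hφ : IsPhys φ) (hφ' : IsPhys φ') :
    l2 ψ (φ + φ') = l2 ψ φ + l2 ψ φ' := by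
  rw [l2_comm, l2_add_left hφ hφ' hψ, l2_comm φ, l2_comm φ']

/-- The fine-translation average is translation invariant. [folklore] -/
theorem avg_torusConfigShift (F : GaugeConfig 3 L SU2 → ℝ) (v : Site 3 L) (U : GaugeConfig 3 L SU2) :
    (Fintype.card (Site 3 L) : ℝ)⁻¹ * ∑ w : Site 3 L, F (torusConfigShift w (torusConfigShift v U)) =
      (Fintype.card (Site 3 L) : ℝ)⁻¹ * ∑ w : Site 3 L, F (torusConfigShift w U) := by
  simp only [torusConfigShift_torusConfigShift]
  congr 1
  exact Fintype.sum_equiv (Equiv.addRight v) _ _ fun w => rfl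

/-! ## The split of the recentred moments -/

section Split

variable {β : ℝ} {F Ω : GaugeConfig 3 L SU2 → ℝ}

/-- The remainder multiplier `F − F̄` is physical. [folklore] -/
theorem isPhys_sub_avg (hF : IsPhys F) :
    IsPhys (fun U : GaugeConfig 3 L SU2 => F U - (Fintype.card (Site 3 L) : ℝ)⁻¹ * ∑ v : Site 3 L, F (torusConfigShift v U)) := by
  have h1 := hF.add ((isPhys_avg hF).smul (-1))
  have e : (F + (-1 : ℝ) • fun U : GaugeConfig 3 L SU2 => (Fintype.card (Site 3 L) : ℝ)⁻¹ * ∑ v : Site 3 L, F (torusConfigShift v U)) =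
      fun U => F U - (Fintype.card (Site 3 L) : ℝ)⁻¹ * ∑ v : Site 3 L, F (torusConfigShift v U) := by
    funext U; simp [sub_eq_add_neg]
  rw [e] at h1; exact h1

omit [NeZero L] in
/-- A physical multiplier times a physical `Ω` is physical. [folklore] -/
theorem isPhys_mul_right {J : GaugeConfig 3 L SU2 → ℝ} (hJ : IsPhys J) (hΩ : IsPhys Ω) :
    IsPhys (fun U => J U * Ω U) :=
  IsPhys.mul_of_invariant hΩ hJ.measurable (Classical.choose_spec hJ.bounded) hJ.gaugeInv hJ.zeroFlux

/-- ★ **Momentum split of the raw trial.**  With `w₀ = F·Ω`, `w̄ = F̄·Ω`, `r = (F − F̄)·Ω` (translation-invariant physical `Ω`, `β` arbitrary):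
`⟨w₀, K_β^n w₀⟩ = ⟨w̄, K_β^n w̄⟩ + ⟨r, K_β^n r⟩` and `⟨w₀, Ω⟩ = ⟨w̄, Ω⟩` — the cross terms vanish because `K_β^n w̄` is translation invariant and
`r` is orthogonal to translation-invariant physical vectors. [cite: ReedSimonIV1978, Thm. XIII.1] -/
theorem moment_raw_eq (β : ℝ) (hF : IsPhys F) (hΩ : IsPhys Ω)
    (hΩTI : ∀ (v : Site 3 L) (U : GaugeConfig 3 L SU2), Ω (torusConfigShift v U) = Ω U) (n : ℕ) :
    l2 (fun U => F U * Ω U) ((transferApply β)^[n] fun U => F U * Ω U) =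
        l2 (fun U => ((Fintype.card (Site 3 L) : ℝ)⁻¹ * ∑ v : Site 3 L, F (torusConfigShift v U)) * Ω U)
            ((transferApply β)^[n] fun U => ((Fintype.card (Site 3 L) : ℝ)⁻¹ * ∑ v : Site 3 L, F (torusConfigShift v U)) * Ω U) +
          l2 (fun U => (F U - (Fintype.card (Site 3 L) : ℝ)⁻¹ * ∑ v : Site 3 L, F (torusConfigShift v U)) * Ω U)
            ((transferApply β)^[n] fun U => (F U - (Fintype.card (Site 3 L) : ℝ)⁻¹ * ∑ v : Site 3 L, F (torusConfigShift v U)) * Ω U) ∧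
      l2 (fun U => F U * Ω U) Ω =
        l2 (fun U => ((Fintype.card (Site 3 L) : ℝ)⁻¹ * ∑ v : Site 3 L, F (torusConfigShift v U)) * Ω U) Ω := by
  have hFb : IsPhys (fun U : GaugeConfig 3 L SU2 => (Fintype.card (Site 3 L) : ℝ)⁻¹ * ∑ v : Site 3 L, F (torusConfigShift v U)) :=
    isPhys_avg hF
  have hFr := isPhys_sub_avg hF
  have hwbP := isPhys_mul_right hFb hΩ
  have hrP := isPhys_mul_right hFr hΩ
  -- `w₀ = w̄ + r`
  have hsum : (fun U => F U * Ω U) =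
      (fun U => ((Fintype.card (Site 3 L) : ℝ)⁻¹ * ∑ v : Site 3 L, F (torusConfigShift v U)) * Ω U) +
        fun U => (F U - (Fintype.card (Site 3 L) : ℝ)⁻¹ * ∑ v : Site 3 L, F (torusConfigShift v U)) * Ω U := by
    funext U; simp only [Pi.add_apply]; ring
  -- `w̄`, hence `K^n w̄`, is translation invariant
  have hwbTI : ∀ (v : Site 3 L) (U : GaugeConfig 3 L SU2),
      ((Fintype.card (Site 3 L) : ℝ)⁻¹ * ∑ w : Site 3 L, F (torusConfigShift w (torusConfigShift v U))) * Ω (torusConfigShift v U) =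
        ((Fintype.card (Site 3 L) : ℝ)⁻¹ * ∑ w : Site 3 L, F (torusConfigShift w U)) * Ω U := fun v U => by
    rw [avg_torusConfigShift, hΩTI]
  have hKwbTI := iterate_transferApply_ti β
    (ψ := fun U => ((Fintype.card (Site 3 L) : ℝ)⁻¹ * ∑ w : Site 3 L, F (torusConfigShift w U)) * Ω U) hwbTI n
  have hKwbP := isPhys_iterate_transferApply β hwbP n
  have hKrP := isPhys_iterate_transferApply β hrP n
  -- the cross terms vanish
  have hcross1 : l2 ((transferApply β)^[n] fun U => ((Fintype.card (Site 3 L) : ℝ)⁻¹ * ∑ v : Site 3 L, F (torusConfigShift v U)) * Ω U)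
      (fun U => (F U - (Fintype.card (Site 3 L) : ℝ)⁻¹ * ∑ v : Site 3 L, F (torusConfigShift v U)) * Ω U) = 0 :=
    l2_remainder_of_ti hKwbP hF hΩ hKwbTI hΩTI
  have hcross2 : l2 (fun U => ((Fintype.card (Site 3 L) : ℝ)⁻¹ * ∑ v : Site 3 L, F (torusConfigShift v U)) * Ω U)
      ((transferApply β)^[n] fun U => (F U - (Fintype.card (Site 3 L) : ℝ)⁻¹ * ∑ v : Site 3 L, F (torusConfigShift v U)) * Ω U) = 0 := by
    rw [← UpStep.l2_iterate_transferApply_comm β hwbP hrP n]; exact hcross1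
  have hcross3 : l2 (fun U => (F U - (Fintype.card (Site 3 L) : ℝ)⁻¹ * ∑ v : Site 3 L, F (torusConfigShift v U)) * Ω U)
      ((transferApply β)^[n] fun U => ((Fintype.card (Site 3 L) : ℝ)⁻¹ * ∑ v : Site 3 L, F (torusConfigShift v U)) * Ω U) = 0 := by
    rw [l2_comm]; exact hcross1
  have hΩr : l2 Ω (fun U => (F U - (Fintype.card (Site 3 L) : ℝ)⁻¹ * ∑ v : Site 3 L, F (torusConfigShift v U)) * Ω U) = 0 :=
    l2_remainder_of_ti hΩ hF hΩ hΩTI hΩTI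
  have hrΩ : l2 (fun U => (F U - (Fintype.card (Site 3 L) : ℝ)⁻¹ * ∑ v : Site 3 L, F (torusConfigShift v U)) * Ω U) Ω = 0 := by
    rw [l2_comm]; exact hΩr
  refine ⟨?_, ?_⟩
  · rw [hsum, UpStep.iterate_transferApply_add β hwbP hrP n, l2_add_left hwbP hrP (hKwbP.add hKrP),
      l2_add_right_phys hwbP hKwbP hKrP, l2_add_right_phys hrP hKwbP hKrP, hcross2, hcross3]
    ring
  · rw [hsum, l2_add_left hwbP hrP hΩ, hrΩ, add_zero]

/-- ★ **Split of the recentred moments**: `R_n(w₀) = R_n(w̄) + ⟨r, K_β^n r⟩` with `R_n(w) = ⟨w,K_β^n w⟩ − λ₀^n⟨w,Ω⟩²`, and the remainder term is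
NON-NEGATIVE for `β ≥ 0` (`moment_nonneg`).  At `n = 0`: `Var(w₀) = Var(w̄) + ‖r‖²`. [cite: ReedSimonIV1978, Thm. XIII.1] -/
theorem recentredMoment_raw_eq (hβ : 0 ≤ β) (hF : IsPhys F) (hΩ : IsPhys Ω)
    (hΩTI : ∀ (v : Site 3 L) (U : GaugeConfig 3 L SU2), Ω (torusConfigShift v U) = Ω U) (n : ℕ) :
    l2 (fun U => F U * Ω U) ((transferApply β)^[n] fun U => F U * Ω U) -
          topValue su2Rep L β ^ n * l2 (fun U => F U * Ω U) Ω ^ 2 =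
        (l2 (fun U => ((Fintype.card (Site 3 L) : ℝ)⁻¹ * ∑ v : Site 3 L, F (torusConfigShift v U)) * Ω U)
              ((transferApply β)^[n] fun U => ((Fintype.card (Site 3 L) : ℝ)⁻¹ * ∑ v : Site 3 L, F (torusConfigShift v U)) * Ω U) -
            topValue su2Rep L β ^ n *
              l2 (fun U => ((Fintype.card (Site 3 L) : ℝ)⁻¹ * ∑ v : Site 3 L, F (torusConfigShift v U)) * Ω U) Ω ^ 2) +
          l2 (fun U => (F U - (Fintype.card (Site 3 L) : ℝ)⁻¹ * ∑ v : Site 3 L, F (torusConfigShift v U)) * Ω U)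
            ((transferApply β)^[n] fun U => (F U - (Fintype.card (Site 3 L) : ℝ)⁻¹ * ∑ v : Site 3 L, F (torusConfigShift v U)) * Ω U) ∧
      0 ≤ l2 (fun U => (F U - (Fintype.card (Site 3 L) : ℝ)⁻¹ * ∑ v : Site 3 L, F (torusConfigShift v U)) * Ω U)
            ((transferApply β)^[n] fun U => (F U - (Fintype.card (Site 3 L) : ℝ)⁻¹ * ∑ v : Site 3 L, F (torusConfigShift v U)) * Ω U) := by
  obtain ⟨hmom, hmean⟩ := moment_raw_eq β hF hΩ hΩTI n
  have hrP := isPhys_mul_right (isPhys_sub_avg hF) hΩ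
  refine ⟨?_, moment_nonneg hβ hrP n⟩
  rw [hmom, hmean]
  ring

/-- The averaged trial is dominated by the raw one: `R_n(w̄) ≤ R_n(w₀)`. [folklore] -/
theorem avgMoment_le_raw (hβ : 0 ≤ β) (hF : IsPhys F) (hΩ : IsPhys Ω)
    (hΩTI : ∀ (v : Site 3 L) (U : GaugeConfig 3 L SU2), Ω (torusConfigShift v U) = Ω U) (n : ℕ) :
    l2 (fun U => ((Fintype.card (Site 3 L) : ℝ)⁻¹ * ∑ v : Site 3 L, F (torusConfigShift v U)) * Ω U)
          ((transferApply β)^[n] fun U => ((Fintype.card (Site 3 L) : ℝ)⁻¹ * ∑ v : Site 3 L, F (torusConfigShift v U)) * Ω U) -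
        topValue su2Rep L β ^ n *
          l2 (fun U => ((Fintype.card (Site 3 L) : ℝ)⁻¹ * ∑ v : Site 3 L, F (torusConfigShift v U)) * Ω U) Ω ^ 2 ≤
      l2 (fun U => F U * Ω U) ((transferApply β)^[n] fun U => F U * Ω U) -
        topValue su2Rep L β ^ n * l2 (fun U => F U * Ω U) Ω ^ 2 := by
  obtain ⟨h, hnn⟩ := recentredMoment_raw_eq hβ hF hΩ hΩTI n
  linarith

/-- At `n = 0`: `Var(w₀) = Var(w̄) + ‖r‖²` (so `Var(w̄) ≤ Var(w₀)` and `‖r‖² ≤ Var(w₀)`). [folklore] -/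
theorem variance_raw_eq (hF : IsPhys F) (hΩ : IsPhys Ω)
    (hΩTI : ∀ (v : Site 3 L) (U : GaugeConfig 3 L SU2), Ω (torusConfigShift v U) = Ω U) (β : ℝ) :
    l2 (fun U => F U * Ω U) (fun U => F U * Ω U) - l2 (fun U => F U * Ω U) Ω ^ 2 =
        (l2 (fun U => ((Fintype.card (Site 3 L) : ℝ)⁻¹ * ∑ v : Site 3 L, F (torusConfigShift v U)) * Ω U)
              (fun U => ((Fintype.card (Site 3 L) : ℝ)⁻¹ * ∑ v : Site 3 L, F (torusConfigShift v U)) * Ω U) -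
            l2 (fun U => ((Fintype.card (Site 3 L) : ℝ)⁻¹ * ∑ v : Site 3 L, F (torusConfigShift v U)) * Ω U) Ω ^ 2) +
          l2 (fun U => (F U - (Fintype.card (Site 3 L) : ℝ)⁻¹ * ∑ v : Site 3 L, F (torusConfigShift v U)) * Ω U)
            (fun U => (F U - (Fintype.card (Site 3 L) : ℝ)⁻¹ * ∑ v : Site 3 L, F (torusConfigShift v U)) * Ω U) := by
  obtain ⟨hmom, hmean⟩ := moment_raw_eq β hF hΩ hΩTI 0
  simp only [Function.iterate_zero, id_eq] at hmom
  rw [hmom, hmean]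
  ring

end Split

/-! ## Raw comparison from averaged comparison plus a leak bound -/

/-- Real-arithmetic core: if `R̄ ≤ R₀`, `V₀ = V̄ + ρ` with `ρ ≤ (1 − e^{−s₂})V₀`, `a, b ≥ 0` and `a·V̄ ≤ e^{s₁}·b·R̄`, then `a·V₀ ≤ e^{s₁+s₂}·b·R₀`.
[folklore] -/
theorem arith_raw_of_avg_of_leak {a b s₁ s₂ V0 Vb ρ R0 Rb : ℝ} (ha : 0 ≤ a) (hb : 0 ≤ b) (hRle : Rb ≤ R0)
    (hV : V0 = Vb + ρ) (hleak : ρ ≤ (1 - Real.exp (-s₂)) * V0) (havg : a * Vb ≤ Real.exp s₁ * (b * Rb)) :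
    a * V0 ≤ Real.exp (s₁ + s₂) * (b * R0) := by
  have hE2 : 0 < Real.exp s₂ := Real.exp_pos _
  have hVb : Real.exp (-s₂) * V0 ≤ Vb := by nlinarith
  have hV0 : V0 ≤ Real.exp s₂ * Vb := by
    have h := mul_le_mul_of_nonneg_left hVb hE2.le
    rwa [← mul_assoc, ← Real.exp_add, add_neg_cancel, Real.exp_zero, one_mul] at h
  calc a * V0 ≤ a * (Real.exp s₂ * Vb) := mul_le_mul_of_nonneg_left hV0 ha
    _ = Real.exp s₂ * (a * Vb) := by ring
    _ ≤ Real.exp s₂ * (Real.exp s₁ * (b * Rb)) := mul_le_mul_of_nonneg_left havg hE2.le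
    _ = Real.exp (s₁ + s₂) * (b * Rb) := by rw [Real.exp_add]; ring
    _ ≤ Real.exp (s₁ + s₂) * (b * R0) :=
        mul_le_mul_of_nonneg_left (mul_le_mul_of_nonneg_left hRle hb) (Real.exp_pos _).le

/-- ★★ **Raw comparison from the averaged comparison plus a leak bound.**  For a translation-invariant physical `Ω` (`β ≥ 0`), a physical
multiplier `F` with plain average `F̄` and remainder `r = (F − F̄)Ω`, constants `a, b ≥ 0`: if the AVERAGED trial `w̄ = F̄Ω` satisfies
`a·Var(w̄) ≤ e^{s₁}·b·R_n(w̄)` and the LEAK bound `‖r‖² ≤ (1 − e^{−s₂})·Var(w₀)` holds for the raw trial `w₀ = FΩ`, then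
`a·Var(w₀) ≤ e^{s₁+s₂}·b·R_n(w₀)`.  (In the engines: `a = λ₁′^{L′}λ₀^{n}`, `b = λ₀′^{L′}`, `F = (φ′/Ω′)∘thin L′`, `Ω` the fine ground state; the
averaged hypothesis is the filed cruxes' comparison WITHOUT any translation-invariance or smear-injectivity demand on `φ′` — it is trivially
consistent when `Var(w̄) = 0`; the leak hypothesis is the non-zero-momentum weight of the raw pull-back under the fine vacuum.)
[cite: ReedSimonIV1978, Thm. XIII.1] [cite: Luscher1983, §3] -/
theorem rawComparison_of_avg_of_leak {β : ℝ} (hβ : 0 ≤ β) {F Ω : GaugeConfig 3 L SU2 → ℝ} (hF : IsPhys F) (hΩ : IsPhys Ω)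
    (hΩTI : ∀ (v : Site 3 L) (U : GaugeConfig 3 L SU2), Ω (torusConfigShift v U) = Ω U) (n : ℕ) {a b s₁ s₂ : ℝ} (ha : 0 ≤ a) (hb : 0 ≤ b)
    (havg : a * (l2 (fun U => ((Fintype.card (Site 3 L) : ℝ)⁻¹ * ∑ v : Site 3 L, F (torusConfigShift v U)) * Ω U)
          (fun U => ((Fintype.card (Site 3 L) : ℝ)⁻¹ * ∑ v : Site 3 L, F (torusConfigShift v U)) * Ω U) -
        l2 (fun U => ((Fintype.card (Site 3 L) : ℝ)⁻¹ * ∑ v : Site 3 L, F (torusConfigShift v U)) * Ω U) Ω ^ 2) ≤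
      Real.exp s₁ * (b * (l2 (fun U => ((Fintype.card (Site 3 L) : ℝ)⁻¹ * ∑ v : Site 3 L, F (torusConfigShift v U)) * Ω U)
          ((transferApply β)^[n] fun U => ((Fintype.card (Site 3 L) : ℝ)⁻¹ * ∑ v : Site 3 L, F (torusConfigShift v U)) * Ω U) -
        topValue su2Rep L β ^ n *
          l2 (fun U => ((Fintype.card (Site 3 L) : ℝ)⁻¹ * ∑ v : Site 3 L, F (torusConfigShift v U)) * Ω U) Ω ^ 2)))
    (hleak : l2 (fun U => (F U - (Fintype.card (Site 3 L) : ℝ)⁻¹ * ∑ v : Site 3 L, F (torusConfigShift v U)) * Ω U)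
          (fun U => (F U - (Fintype.card (Site 3 L) : ℝ)⁻¹ * ∑ v : Site 3 L, F (torusConfigShift v U)) * Ω U) ≤
      (1 - Real.exp (-s₂)) * (l2 (fun U => F U * Ω U) (fun U => F U * Ω U) - l2 (fun U => F U * Ω U) Ω ^ 2)) :
    a * (l2 (fun U => F U * Ω U) (fun U => F U * Ω U) - l2 (fun U => F U * Ω U) Ω ^ 2) ≤
      Real.exp (s₁ + s₂) * (b * (l2 (fun U => F U * Ω U) ((transferApply β)^[n] fun U => F U * Ω U) -
        topValue su2Rep L β ^ n * l2 (fun U => F U * Ω U) Ω ^ 2)) :=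
  arith_raw_of_avg_of_leak ha hb (avgMoment_le_raw hβ hF hΩ hΩTI n) (variance_raw_eq hF hΩ hΩTI β) hleak havg

end Summit.QuantumFields.YangMills.Theorems.FlatTubeReduction.PinnedSpan

end
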